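import Summits.CriticalPhenomena.PercolationContinuityZ3.Theorems.Transplant.PlanarCellsDefs
import HarnessLib

/-!
# Kozma–Nitzan's planar cells in `ℤ²`, part 3: the faces `F^j_{v,x}` and the full corridor `H_{v,x}` of a macro-edge, with the four
# containments of p2-g2's `StepsGeom` (planar halves; BLUEPRINT-I-PHI §1 rows "cells", "Lemma 12")

builds on p205010 (kernel theorem, internal audit signed; external expert review pending) — nothing in this file uses p205010.
Lane `prim-bschramm`, seat `prim-bschramm-p3`; helper file (`--supports stmt-CriticalPhenomena-4575 --as helper`).  Continues `PlanarCellsDefs`.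

* `Face v δ j = cen v + {σ x_a = 5r + 10sj} × [-2r, 2r]`, `Hfull v δ = cen v + {5r ≤ σ x_a ≤ 22r} × [-2r, 2r]` (KN's `Cells.Face/Hfull` at
  `d = 2`);
* `Face_subset_Stub`, `Stub_subset_Hfull` (`j ≤ K`), `Hfull_subset_Q_union_Efar`, `M_add_stepVec_subset_Efar` — the planar halves of the
  fields of `KNCells.StepsGeom`.

[cite: KozmaNitzan2024, §4 p. 26 (H_{v,x}), p. 30 (F^j_{v,x}) — the ℤ^d model]
-/

noncomputable section

namespace Summit.CriticalPhenomena.PercolationContinuityZ3.Theorems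

namespace Transplant

open Literature.Probability.Percolation Literature.Probability.LatticeModels SimpleGraph GadgetSystem Contour
open Literature.Probability.Percolation.KozmaNitzan
open Literature.Probability.Percolation.KozmaNitzan.Cells (oth oth_ne sgOf sgOf_sign stepVec_apply_fst stepVec_apply_oth eq_oth_of_ne)

namespace PCells

variable (C : PCells)

/-- The face `F^j_{v,x} = cen v + {σ x_a = 5r + 10sj} × [-2r,2r]`. [cite: KozmaNitzan2024, §4 p. 30 (F^j_{v,x})] -/
def Face (v : Site 2) (δ : MDir) (j : ℕ) : Finset (Site 2) :=
  sBox δ.1 (sgOf δ) (C.cen v) (5 * C.r + 10 * C.s * j) (5 * C.r + 10 * C.s * j) (2 * C.r)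

/-- The full corridor `H_{v,x} = cen v + {5r ≤ σ x_a ≤ 22r} × [-2r,2r]`. [cite: KozmaNitzan2024, §4 p. 26 (H_{v,x})] -/
def Hfull (v : Site 2) (δ : MDir) : Finset (Site 2) := sBox δ.1 (sgOf δ) (C.cen v) (5 * C.r) (22 * C.r) (2 * C.r)

/-- The face of level `j` lies in the stub of level `j`. [folklore] -/
theorem Face_subset_Stub (v : Site 2) (δ : MDir) (j : ℕ) : (C.Face v δ j : Finset (Site 2)) ⊆ C.Stub v δ j := by
  intro t ht
  rw [Face, mem_psBox_iff] at ht
  rw [Stub, mem_psBox_iff]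
  obtain ⟨⟨h1, h2⟩, h3, h4⟩ := ht
  have : (0 : ℤ) ≤ 10 * C.s * j := by positivity
  exact ⟨⟨by omega, h2⟩, h3, h4⟩

/-- Stubs of level `≤ K` lie in the full corridor (`10 s K = 10 r`). [folklore] -/
theorem Stub_subset_Hfull (v : Site 2) (δ : MDir) {j : ℕ} (hj : j ≤ C.K) : (C.Stub v δ j : Finset (Site 2)) ⊆ C.Hfull v δ := by
  intro t ht
  rw [Stub, mem_psBox_iff] at ht
  rw [Hfull, mem_psBox_iff]
  obtain ⟨⟨h1, h2⟩, h3, h4⟩ := ht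
  have hsj : 10 * (C.s : ℤ) * j ≤ 10 * C.r := by
    have : C.s * j ≤ C.s * C.K := Nat.mul_le_mul_left _ hj
    have hr : (C.r : ℤ) = C.K * C.s := by simp [r]
    nlinarith
  exact ⟨⟨h1, by omega⟩, h3, h4⟩

/-- The full corridor lies in `Q_v ∪ E^far_{v,x}`. [folklore] -/
theorem Hfull_subset_Q_union_Efar (v : Site 2) (δ : MDir) : (C.Hfull v δ : Finset (Site 2)) ⊆ C.Q v ∪ C.Efar v δ := by
  intro t ht
  rw [Hfull, mem_psBox_iff] at ht
  obtain ⟨⟨h1, h2⟩, h3, h4⟩ := ht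
  rw [Finset.mem_union, Q, C.mem_sq_iff, Efar, mem_psBox_iff]
  by_cases hlev : sgOf δ * (t δ.1 - C.cen v δ.1) ≤ 5 * C.r
  · left
    intro i
    rcases eq_or_ne i δ.1 with rfl | hi
    · rcases sgOf_sign δ with hs | hs <;> rw [hs] at h1 hlev <;> push_cast <;> constructor <;> omega
    · rw [eq_oth_of_ne hi]; push_cast; constructor <;> omega
  · right
    exact ⟨⟨by omega, by omega⟩, by omega, by omega⟩

/-- The target cube lies in the far region: `M_{v+δ} ⊆ E^far_{v,δ}`. [folklore] -/
theorem M_add_stepVec_subset_Efar (v : Site 2) (δ : MDir) : (C.M (v + stepVec δ) : Finset (Site 2)) ⊆ C.Efar v δ := by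
  intro t ht
  rw [M, C.mem_sq_iff] at ht
  rw [Efar, mem_psBox_iff]
  have hf := C.cen_add_stepVec_fst v δ
  have ho := C.cen_add_stepVec_oth v δ
  have ha := ht δ.1
  have hb := ht (oth δ.1)
  rw [hf] at ha
  rw [ho] at hb
  push_cast at ha hb
  have hr : (1 : ℤ) ≤ C.r := by exact_mod_cast C.one_le_r
  refine ⟨?_, by omega, by omega⟩
  rcases sgOf_sign δ with hs | hs <;> rw [hs] at ha ⊢ <;> constructor <;> omega

end PCells

end Transplant

end Summit.CriticalPhenomena.PercolationContinuityZ3.Theorems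

end
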